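import Summits.QuantumFields.YangMills.Theorems.BalabanUVNodesN14ConvexFibreConsistency
import Literature.MathematicalPhysics.QuantumFieldTheory.Balaban1983to89.T4CauchySum

/-!
# BalabanUVNodes ∕ node N14 = NE1′ — THE ENGINE REACHES N19's STATEMENT-OF-RECORD SHAPE ON THE WHOLE-MEASURE TEMPLATE: one step of the
# `δ`-consistent schema tower with a re-coordinatisation and an OBSERVABLE defect, then `T4CauchySum.MatchingModConstants` + summable remainders
# ⇒ the generating functions are Cauchy in the number of steps

Cell `pub-ymgap`, HUMAN RULING D-0062 (Track A at full width), seat `pub-ymgap-dag-n14-c` (R134 ACCELERATION, strategy s1), generation 5;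
route `Summits/QuantumFields/YangMills/Theses/BalabanUVNodes.lean` rev 16∕17 (cluster K3‴ `SpineGivenEndpointR13` = stmt-QuantumFields-19912,
`--supports … --as helper`; the residual binder feeds `DressedMGFForm.core_of_mgfForm` ⇒ `NE7.Core`, the skeleton's `KeyedCoreEdge`); venue ruling R424
(`YangMills/Theorems`, namespace `YMDAG.N14.ConvexFibreCauchy`).  Eleventh file of the convex-fibre engine (A `…Engine` · B `…Window` · C `…Step` ·
D `…Box` · E `…Tilt` · F `…Perturb` · G `…Matching` · H `…MatchingBox` · I `…TEA` · J `…Consistency`).  ADDITIVE — imports J (hence G's two-tilt lemma,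
H's schema step, C's fibre-average lemmas, the gaps-ne1 `Spine/NE1p/DressedMGFForm` calculus incl. `matchingModConstants_of_tiltedMeans`) and
`Literature/…/T4CauchySum` (node U5's OUTPUT SHAPE `MatchingModConstants`, `genFun`, `cauchySeq_genFun`); THEOREMS ONLY (0 `def`), modifies nothing.

WHY.  Files G∕H∕J produce N14's residual binder `TiltedMeanMatching` on (δ-)consistent towers, class by class.  N19's decl of record is one storey
up: `T4CauchySum.MatchingModConstants vol l₀ δ Z ∧ Summable δ` for the dressed partition functions `Z K t` — and gaps-ne1's
`DressedMGFForm.matchingModConstants_of_tiltedMeans` says that for MGF-form partition functions of WHOLE measures this is EXACTLY a summable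
one-step matching of source-tilted first moments, `|tiltedMean F_{K+1} μ_{K+1} s − tiltedMean F_K μ_K s| ≤ η K` on `|s| ≤ l₀`.  This file runs
the engine on the whole-measure template tower — run `K+1`'s law is run `K`'s exact marginal with ONE schema fibre attached, RE-COORDINATISED
(`μ (K+1) = (ν K ⊗ₘ κ K).map (e K)`: (block field, fluctuation) ↦ fine field), run `K`'s law is that marginal up to the renormalisation-group
defect (`μ K = (ν K).tilted (g K)`, `|g K| ≤ δ K`), run `K+1`'s observable read in split coordinates is `G K` and run `K`'s observable is `G K`'s
fibre average up to an OBSERVABLE defect `ε K` (the loop on the block field vs. the fluctuation average of the loop on the fine field) — and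
obtains N19's shape with `vol·δ′ K = l₀·η K`, `η K = O((L K)²) + O(δ K) + O(ε K)`: summable iff the fibre gradients are square-summable AND both
defects are summable; then `T4CauchySum.cauchySeq_genFun` makes every generating function `K ↦ genFun Z K t`, `|t| ≤ l₀`, CAUCHY.

WHAT THIS IS.
* §1 GENERIC [folklore]: `tiltedMean_map` (the tilted mean is invariant under a measurable re-coordinatisation: `tiltedMean F (μ.map e) s =
  tiltedMean (F ∘ e) μ s`), `abs_tiltedMean_sub_tiltedMean_le_of_abs_sub_le` (the OBSERVABLE defect: `|F − F′| ≤ ε`, both `B₀`-bounded ⇒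
  `|tiltedMean F μ s − tiltedMean F′ μ s| ≤ ε + B₀·(e^{2|s|ε} − 1)`; J's `abs_tiltedMean_tilted_sub_le` is the LAW defect),
  `summable_exp_sub_one` (`Σ a_K < ∞`, `a_K ≥ 0` ⇒ `Σ (e^{a_K} − 1) < ∞`), `matchingModConstants_of_mul_pos` (constants quotient out: rescaling every
  `Z K` by a positive `t`-independent factor keeps `MatchingModConstants` — so normalising the run laws is no loss).
* §2 **`abs_tiltedMean_step_le`** — ONE STEP: background `ν` (probability), Markov fibre kernel `κ` into `EuclideanSpace ℝ (Fin n)` with RR-2's schema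
  `HasEntropyExpC1c (κ b) C` for every `b` (`C > 0`; convex laws `C = 1∕λ`, box laws `C = 1∕c` by Bobkov–Ledoux — files D∕F∕H), `G` measurable,
  `|G| ≤ B₀`, fibrewise `C¹` with gradient `≤ L` (`L > 0`), a measurable re-coordinatisation `e` with `F₁ ∘ e = G`, a defect tilt `|g| ≤ δ`, and a
  `B₀`-bounded `F₀` with `|F₀ − Ḡ| ≤ ε`:  `|tiltedMean F₁ ((ν ⊗ₘ κ).map e) s − tiltedMean F₀ (ν.tilted g) s| ≤
  |s|·C·e^{4l₀B₀}·L² + B₀·(e^{C·L²·s²} − 1) + B₀·(e^{2δ} − 1) + ε + B₀·(e^{2|s|ε} − 1)` for `|s| ≤ l₀`.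
* §3 THE TOWER (`Ω : ℕ → Type`, probability laws `μ K`, exact marginals `ν K`, fibres `κ K`, maps `e K : Ω K × E_K → Ω (K+1)`):
  `abs_tiltedMean_succ_sub_le` (the one-step matching with `η K`), **`matchingModConstants_of_schemaTower`** (`T4CauchySum.MatchingModConstants vol l₀
  (fun K => l₀ ∕ vol · η K) Z` for `Z K t = mgf (F K) (μ K) t`, by `matchingModConstants_of_tiltedMeans` BY NAME), `summable_eta` (Σ(L K)² + Σδ K + Σε K < ∞
  ⇒ `Summable η`), **`cauchySeq_genFun_of_schemaTower`** (⇒ `CauchySeq (fun K => genFun Z K t)` for `|t| ≤ l₀`), and the uniformly-log-concave instance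
  `matchingModConstants_of_convexTower` (fibres `e^{−V K (b,·)}dx∕Z`, `V K (b,·)` continuous `λ`-convex: `C = 1∕λ` by file A's Bakry–Émery schema).

WHAT THIS IS NOT.  Everything here is PROVED (0 `sorry`, 0 named facts).  The template is the NO-LARGE-FIELD caricature (whole measures: no classes,
no shells, no `Bad`); its four letters — the schema∕convexity constant `C` of the history-conditioned fibre actions uniformly in the history (NODE O's
positivity; N20's TEA letters via file I), the fibre-gradient sizes `L K` (`T4LoopPullback`'s `θ₁` in the linearised model), the law defect `δ K`
(NE5∕NE7's renormalisation-group corrections) and the observable defect `ε K` — are HYPOTHESES consumed by name, none produced here.  Nothing of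
Bałaban's instantiated; N14 NOT discharged; N19 NOT discharged (its decl quantifies the dressed partition functions OF RECORD); count-neutral.
One finite four-torus programme at fixed ε; NOT ℝ⁴, NOT OS, NOT a mass gap, NOT Clay.
-/

noncomputable section

namespace YMDAG.N14.ConvexFibreCauchy

open MeasureTheory ProbabilityTheory Set Filter Topology
open scoped RealInnerProductSpace ENNReal NNReal
open Literature.Analysis.FunctionSpaces (HasEntropyExpC1c isProbabilityMeasure_tilted_neg)
open Literature.MathematicalPhysics.QuantumFieldTheory.Balaban1983to89.T4CauchySum (MatchingModConstants genFun cauchySeq_genFun)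
open Summit.QuantumFields.BalabanUV.T4Continuum.NE1p.DressedMGFForm (tiltedMean matchingModConstants_of_tiltedMeans)
open YMDAG.N14.ConvexFibreEngine (entropyC1c_of_uniformlyConvex)
open YMDAG.N14.ConvexFibreStep (measurable_fibreAvg abs_fibreAvg_le)
open YMDAG.N14.ConvexFibreMatching (abs_integral_tilted_sub_tilted_le)
open YMDAG.N14.ConvexFibreConsistency (abs_tiltedMean_compProd_sub_le_of_defect)

variable {n : ℕ}

/-! ## §1 Generic: re-coordinatisation, the observable defect, summability of `e^{a_K} − 1`, constants quotient out -/
section Generic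

variable {Ω Ω' : Type*} [MeasurableSpace Ω] [MeasurableSpace Ω']

/-- **THE TILTED MEAN IS INVARIANT UNDER A MEASURABLE RE-COORDINATISATION** [folklore]: for measurable `e : Ω → Ω'` and measurable `F : Ω' → ℝ`,
`tiltedMean F (μ.map e) s = tiltedMean (F ∘ e) μ s` (Mathlib `integral_tilted`, `integral_map`). -/
theorem tiltedMean_map {μ : Measure Ω} {e : Ω → Ω'} (he : Measurable e) {F : Ω' → ℝ} (hF : Measurable F) (s : ℝ) :
    tiltedMean F (μ.map e) s = tiltedMean (F ∘ e) μ s := by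
  simp only [tiltedMean, integral_tilted]
  have h1 : ∫ x, Real.exp (s * F x) ∂(μ.map e) = ∫ y, Real.exp (s * F (e y)) ∂μ :=
    integral_map he.aemeasurable ((Real.measurable_exp.comp (hF.const_mul s)).aestronglyMeasurable)
  have h2 : ∫ x, (Real.exp (s * F x) / ∫ x, Real.exp (s * F x) ∂(μ.map e)) • F x ∂(μ.map e) =
      ∫ y, (Real.exp (s * F (e y)) / ∫ x, Real.exp (s * F x) ∂(μ.map e)) • F (e y) ∂μ :=
    integral_map he.aemeasurable
      ((((Real.measurable_exp.comp (hF.const_mul s)).div_const _).smul hF).aestronglyMeasurable)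
  rw [h2, h1]
  rfl

/-- **THE OBSERVABLE DEFECT** [folklore ∘ G's two-tilt lemma]: `μ` a probability law, `F`, `F′` measurable, `|F| ≤ B₀`, `|F′| ≤ B₀`, `|F − F′| ≤ ε`
pointwise ⇒ for every tilt `s`, `|tiltedMean F μ s − tiltedMean F′ μ s| ≤ ε + B₀·(e^{2|s|ε} − 1)` (the means under the common tilt `sF` differ by `≤ ε`;
the tilts `sF`, `sF′` differ by `≤ |s|ε`, which moves the mean of `F′` by `≤ B₀(e^{2|s|ε} − 1)`). -/
theorem abs_tiltedMean_sub_tiltedMean_le_of_abs_sub_le {μ : Measure Ω} [IsProbabilityMeasure μ] {F F' : Ω → ℝ} {B₀ ε : ℝ}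
    (hFm : Measurable F) (hF'm : Measurable F') (hFb : ∀ x, |F x| ≤ B₀) (hF'b : ∀ x, |F' x| ≤ B₀) (hε : ∀ x, |F x - F' x| ≤ ε) (s : ℝ) :
    |tiltedMean F μ s - tiltedMean F' μ s| ≤ ε + B₀ * (Real.exp (2 * (|s| * ε)) - 1) := by
  -- the common tilt `sF` is a probability law
  have hint : Integrable (fun x => Real.exp (s * F x)) μ := by
    have := Literature.Probability.Moments.integrable_exp_mul_of_abs_le_const μ hFm hFb s; simpa using this
  haveI : IsProbabilityMeasure (μ.tilted fun x => s * F x) := isProbabilityMeasure_tilted hint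
  -- (a) the means of `F` and `F′` under the common tilt differ by `≤ ε`
  have hFi : Integrable F (μ.tilted fun x => s * F x) :=
    Integrable.of_bound hFm.aestronglyMeasurable B₀ (Eventually.of_forall fun x => by rw [Real.norm_eq_abs]; exact hFb x)
  have hF'i : Integrable F' (μ.tilted fun x => s * F x) :=
    Integrable.of_bound hF'm.aestronglyMeasurable B₀ (Eventually.of_forall fun x => by rw [Real.norm_eq_abs]; exact hF'b x)
  have ha : |∫ x, F x ∂(μ.tilted fun x => s * F x) - ∫ x, F' x ∂(μ.tilted fun x => s * F x)| ≤ ε := by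
    rw [← integral_sub hFi hF'i]
    have h := norm_integral_le_of_norm_le_const (μ := μ.tilted fun x => s * F x) (f := fun x => F x - F' x) (C := ε)
      (Eventually.of_forall fun x => by rw [Real.norm_eq_abs]; exact hε x)
    rw [Real.norm_eq_abs] at h
    simpa using h
  -- (b) the two tilts `sF`, `sF′` differ by `≤ |s|ε`
  have hsFb : ∀ x, |s * F x| ≤ |s| * B₀ := fun x => by rw [abs_mul]; exact mul_le_mul_of_nonneg_left (hFb x) (abs_nonneg s)
  have hsF'b : ∀ x, |s * F' x| ≤ |s| * B₀ := fun x => by rw [abs_mul]; exact mul_le_mul_of_nonneg_left (hF'b x) (abs_nonneg s)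
  have hb : |∫ x, F' x ∂(μ.tilted fun x => s * F x) - ∫ x, F' x ∂(μ.tilted fun x => s * F' x)| ≤ B₀ * (Real.exp (2 * (|s| * ε)) - 1) :=
    abs_integral_tilted_sub_tilted_le (ν := μ) (hFm.const_mul s) (hF'm.const_mul s) hsFb hsF'b hF'm hF'b fun x => by
      rw [← mul_sub, abs_mul]; exact mul_le_mul_of_nonneg_left (hε x) (abs_nonneg s)
  rw [tiltedMean, tiltedMean]
  calc |∫ x, F x ∂(μ.tilted fun x => s * F x) - ∫ x, F' x ∂(μ.tilted fun x => s * F' x)|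
      ≤ |∫ x, F x ∂(μ.tilted fun x => s * F x) - ∫ x, F' x ∂(μ.tilted fun x => s * F x)| +
          |∫ x, F' x ∂(μ.tilted fun x => s * F x) - ∫ x, F' x ∂(μ.tilted fun x => s * F' x)| := abs_sub_le _ _ _
    _ ≤ ε + B₀ * (Real.exp (2 * (|s| * ε)) - 1) := add_le_add ha hb

/-- **SUMMABLE EXPONENTS GIVE SUMMABLE `e^{a_K} − 1`** [folklore]: `a_K ≥ 0`, `Σ a_K < ∞` ⇒ `Σ (e^{a_K} − 1) < ∞` (each `a_K ≤ Σ a`, so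
`e^{a_K} − 1 ≤ a_K·e^{Σ a}`). -/
theorem summable_exp_sub_one {a : ℕ → ℝ} (ha : Summable a) (h0 : ∀ K, 0 ≤ a K) : Summable fun K => Real.exp (a K) - 1 := by
  have hle : ∀ K, a K ≤ ∑' J, a J := fun K => ha.le_tsum K fun J _ => h0 J
  -- `e^{x} − 1 ≤ x·e^{x}` (the tree's `AreaLaw.exp_sub_one_le_mul_exp`, inlined: `(1 − x)e^{x} ≤ e^{−x}e^{x} = 1`)
  have hexp : ∀ x : ℝ, Real.exp x - 1 ≤ x * Real.exp x := fun x => by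
    have hprod : Real.exp x * Real.exp (-x) = 1 := by rw [← Real.exp_add, add_neg_cancel, Real.exp_zero]
    nlinarith [Real.exp_pos x, Real.exp_pos (-x), mul_le_mul_of_nonneg_left (Real.one_sub_le_exp_neg x) (Real.exp_pos x).le]
  refine Summable.of_nonneg_of_le (fun K => by linarith [Real.add_one_le_exp (a K), h0 K])
    (fun K => (hexp (a K)).trans (mul_le_mul_of_nonneg_left (Real.exp_le_exp.2 (hle K)) (h0 K))) ?_
  exact ha.mul_right _

/-- **CONSTANTS QUOTIENT OUT** [folklore]: rescaling every partition function `Z K` by a positive `t`-independent factor `a K` keeps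
`MatchingModConstants vol l₀ δ` (the constant `c_K` shifts by `log a (K+1) − log a K`) — so NORMALISING the run laws to probability laws, as §3 does,
loses nothing at N19's statement. -/
theorem matchingModConstants_of_mul_pos {vol l₀ : ℝ} {δ : ℕ → ℝ} {Z Z' : ℕ → ℝ → ℝ} {a : ℕ → ℝ} (h : MatchingModConstants vol l₀ δ Z)
    (ha : ∀ K, 0 < a K) (hZ : ∀ K t, |t| ≤ l₀ → 0 < Z K t) (hZ' : ∀ K t, |t| ≤ l₀ → Z' K t = a K * Z K t) :
    MatchingModConstants vol l₀ δ Z' := by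
  intro K
  obtain ⟨c, hc⟩ := h K
  refine ⟨c + (Real.log (a (K + 1)) - Real.log (a K)), fun t ht => ?_⟩
  rw [hZ' K t ht, hZ' (K + 1) t ht, Real.log_mul (ha _).ne' (hZ _ t ht).ne', Real.log_mul (ha _).ne' (hZ _ t ht).ne']
  have := hc t ht
  calc |Real.log (a (K + 1)) + Real.log (Z (K + 1) t) - (Real.log (a K) + Real.log (Z K t)) - (c + (Real.log (a (K + 1)) - Real.log (a K)))|
      = |Real.log (Z (K + 1) t) - Real.log (Z K t) - c| := by ring_nf
    _ ≤ vol * δ K := this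

end Generic

/-! ## §2 One step of the tower: exact marginal with one schema fibre, re-coordinatised, against the defective marginal read with a defective observable -/
section Step

variable {B Ω₁ : Type*} [MeasurableSpace B] [MeasurableSpace Ω₁] {ν : Measure B} [IsProbabilityMeasure ν]
  {κ : Kernel B (EuclideanSpace ℝ (Fin n))} [IsMarkovKernel κ] {G : B × EuclideanSpace ℝ (Fin n) → ℝ} {g F₀ : B → ℝ}
  {e : B × EuclideanSpace ℝ (Fin n) → Ω₁} {F₁ : Ω₁ → ℝ} {C l₀ s B₀ L δ ε : ℝ}

/-- **ONE STEP OF THE TOWER** [folklore ∘ J's `abs_tiltedMean_compProd_sub_le_of_defect` + §1].  Run `K+1` = the exact marginal `ν` with ONE schema fibre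
`κ` attached (`HasEntropyExpC1c (κ b) C` for every `b`, `C > 0`), re-coordinatised by a measurable `e`, read by a measurable `F₁` with `F₁ ∘ e = G` (`G` measurable,
`|G| ≤ B₀`, fibrewise `C¹`, fibre gradient `≤ L`, `L > 0`); run `K` = the DEFECTIVE marginal `ν.tilted g` (`g` measurable, `|g| ≤ δ`) read by a measurable
`B₀`-bounded `F₀` within `ε` of `G`'s fibre average.  Then for `|s| ≤ l₀`:
`|tiltedMean F₁ ((ν ⊗ₘ κ).map e) s − tiltedMean F₀ (ν.tilted g) s| ≤ |s|·C·e^{4l₀B₀}·L² + B₀·(e^{C·L²·s²} − 1) + B₀·(e^{2δ} − 1) + (ε + B₀·(e^{2|s|ε} − 1))`. -/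
theorem abs_tiltedMean_step_le (hκC : ∀ b, HasEntropyExpC1c (κ b) C) (hC : 0 < C) (hGm : Measurable G)
    (hG : ∀ b, ContDiff ℝ 1 fun x => G (b, x)) (hGb : ∀ p, |G p| ≤ B₀) (hGD : ∀ b x, ‖fderiv ℝ (fun z => G (b, z)) x‖ ≤ L) (hL : 0 < L)
    (hs : |s| ≤ l₀) (hgm : Measurable g) (hgb : ∀ b, |g b| ≤ δ) (he : Measurable e) (hF₁m : Measurable F₁) (hF₁ : ∀ p, F₁ (e p) = G p)
    (hF₀m : Measurable F₀) (hF₀b : ∀ b, |F₀ b| ≤ B₀) (hε : ∀ b, |F₀ b - ∫ x, G (b, x) ∂(κ b)| ≤ ε) :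
    |tiltedMean F₁ ((ν ⊗ₘ κ).map e) s - tiltedMean F₀ (ν.tilted g) s| ≤
      |s| * (C * Real.exp (4 * l₀ * B₀) * L ^ 2) + B₀ * (Real.exp (C * L ^ 2 * s ^ 2) - 1) + B₀ * (Real.exp (2 * δ) - 1) +
        (ε + B₀ * (Real.exp (2 * (|s| * ε)) - 1)) := by
  -- run K+1 read in split coordinates IS `G` under `ν ⊗ₘ κ`
  have hcomp : F₁ ∘ e = G := funext hF₁
  have e1 : tiltedMean F₁ ((ν ⊗ₘ κ).map e) s = tiltedMean G (ν ⊗ₘ κ) s := by rw [tiltedMean_map he hF₁m, hcomp]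
  -- the defective marginal is a probability law
  have hgi : Integrable (fun b => Real.exp (g b)) ν := by
    have := Literature.Probability.Moments.integrable_exp_mul_of_abs_le_const ν hgm hgb 1; simpa using this
  haveI : IsProbabilityMeasure (ν.tilted g) := isProbabilityMeasure_tilted hgi
  have hA := abs_tiltedMean_compProd_sub_le_of_defect (ν := ν) (κ := κ) hκC hC hGm hG hGb hGD hL hs hgm hgb
  have hBm : Measurable fun b => ∫ x, G (b, x) ∂(κ b) := measurable_fibreAvg (κ := κ) hGm
  have hBb : ∀ b, |∫ x, G (b, x) ∂(κ b)| ≤ B₀ := abs_fibreAvg_le (κ := κ) hGb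
  have hO := abs_tiltedMean_sub_tiltedMean_le_of_abs_sub_le (μ := ν.tilted g) hBm hF₀m hBb hF₀b (fun b => by
    rw [abs_sub_comm]; exact hε b) s
  rw [e1]
  calc |tiltedMean G (ν ⊗ₘ κ) s - tiltedMean F₀ (ν.tilted g) s|
      ≤ |tiltedMean G (ν ⊗ₘ κ) s - tiltedMean (fun b => ∫ x, G (b, x) ∂(κ b)) (ν.tilted g) s| +
          |tiltedMean (fun b => ∫ x, G (b, x) ∂(κ b)) (ν.tilted g) s - tiltedMean F₀ (ν.tilted g) s| := abs_sub_le _ _ _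
    _ ≤ _ := add_le_add hA hO

end Step

/-! ## §3 The tower: N19's `MatchingModConstants` with summable remainders, hence Cauchy generating functions -/
section Tower

variable {Ω : ℕ → Type*} [∀ K, MeasurableSpace (Ω K)] {d : ℕ → ℕ} {l₀ B₀ C vol : ℝ} {L δ ε : ℕ → ℝ}
  {μ ν : ∀ K, Measure (Ω K)} {κ : ∀ K, Kernel (Ω K) (EuclideanSpace ℝ (Fin (d K)))}
  {G : ∀ K, Ω K × EuclideanSpace ℝ (Fin (d K)) → ℝ} {g : ∀ K, Ω K → ℝ} {e : ∀ K, Ω K × EuclideanSpace ℝ (Fin (d K)) → Ω (K + 1)}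
  {F : ∀ K, Ω K → ℝ} {Z : ℕ → ℝ → ℝ}

/-- **THE ONE-STEP MATCHING ALONG THE TOWER** [folklore ∘ §2].  Depth `K`: `ν K` the exact marginal (a probability law on `Ω K`), run `K`'s law
`μ K = (ν K).tilted (g K)` (`|g K| ≤ δ K`), run `K+1`'s law `μ (K+1) = (ν K ⊗ₘ κ K).map (e K)` with the schema fibres `κ K`, run `K+1`'s observable in
split coordinates `F (K+1) ∘ e K = G K` (letters `B₀`, `L K`), run `K`'s observable within `ε K` of `G K`'s fibre average.  Then for all `|s| ≤ l₀`:
`|tiltedMean (F (K+1)) (μ (K+1)) s − tiltedMean (F K) (μ K) s| ≤ η K`,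
`η K = l₀·C·e^{4l₀B₀}(L K)² + B₀(e^{C(L K)²l₀²} − 1) + B₀(e^{2δ K} − 1) + ε K + B₀(e^{2l₀ε K} − 1)`. -/
theorem abs_tiltedMean_succ_sub_le (hC : 0 < C) (hB₀ : 0 ≤ B₀) (hν : ∀ K, IsProbabilityMeasure (ν K)) (hκM : ∀ K, IsMarkovKernel (κ K))
    (hκC : ∀ K b, HasEntropyExpC1c (κ K b) C) (hGm : ∀ K, Measurable (G K)) (hG : ∀ K b, ContDiff ℝ 1 fun x => G K (b, x))
    (hGb : ∀ K p, |G K p| ≤ B₀) (hGD : ∀ K b x, ‖fderiv ℝ (fun z => G K (b, z)) x‖ ≤ L K) (hL : ∀ K, 0 < L K)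
    (hgm : ∀ K, Measurable (g K)) (hgb : ∀ K b, |g K b| ≤ δ K) (he : ∀ K, Measurable (e K)) (hFm : ∀ K, Measurable (F K))
    (hFb : ∀ K x, |F K x| ≤ B₀) (hFe : ∀ K p, F (K + 1) (e K p) = G K p) (hε0 : ∀ K, 0 ≤ ε K)
    (hε : ∀ K b, |F K b - ∫ x, G K (b, x) ∂(κ K b)| ≤ ε K)
    (hA : ∀ K, μ K = (ν K).tilted (g K)) (hB : ∀ K, μ (K + 1) = ((ν K) ⊗ₘ κ K).map (e K)) (K : ℕ) {s : ℝ} (hs : |s| ≤ l₀) :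
    |tiltedMean (F (K + 1)) (μ (K + 1)) s - tiltedMean (F K) (μ K) s| ≤
      l₀ * (C * Real.exp (4 * l₀ * B₀) * L K ^ 2) + B₀ * (Real.exp (C * L K ^ 2 * l₀ ^ 2) - 1) + B₀ * (Real.exp (2 * δ K) - 1) +
        (ε K + B₀ * (Real.exp (2 * (l₀ * ε K)) - 1)) := by
  haveI := hν K
  haveI := hκM K
  rw [hB K, hA K]
  have h := abs_tiltedMean_step_le (ν := ν K) (κ := κ K) (hκC K) hC (hGm K) (hG K) (hGb K) (hGD K) (hL K) hs (hgm K) (hgb K) (he K)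
    (hFm (K + 1)) (hFe K) (hFm K) (hFb K) (hε K)
  refine h.trans (add_le_add (add_le_add (add_le_add ?_ ?_) le_rfl) (add_le_add le_rfl ?_))
  · exact mul_le_mul_of_nonneg_right hs (by positivity)
  · refine mul_le_mul_of_nonneg_left ?_ hB₀
    have hss : s ^ 2 ≤ l₀ ^ 2 := by
      rw [← sq_abs s]; exact pow_le_pow_left₀ (abs_nonneg s) hs 2
    have : C * L K ^ 2 * s ^ 2 ≤ C * L K ^ 2 * l₀ ^ 2 := mul_le_mul_of_nonneg_left hss (by positivity)
    linarith [Real.exp_le_exp.2 this]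
  · refine mul_le_mul_of_nonneg_left ?_ hB₀
    have : 2 * (|s| * ε K) ≤ 2 * (l₀ * ε K) := by nlinarith [hε0 K, abs_nonneg s]
    linarith [Real.exp_le_exp.2 this]

/-- **N19's STATEMENT-OF-RECORD SHAPE ON THE SCHEMA TOWER** [folklore ∘ `abs_tiltedMean_succ_sub_le` + gaps-ne1's `matchingModConstants_of_tiltedMeans`].
Under the hypotheses of `abs_tiltedMean_succ_sub_le` and `vol > 0`, the MGF-form partition functions `Z K t = mgf (F K) (μ K) t` MATCH MODULO CONSTANTS:
`T4CauchySum.MatchingModConstants vol l₀ (fun K => l₀ ∕ vol · η K) Z`, with the explicit constants `c_K = log Z (K+1) 0 − log Z K 0`. -/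
theorem matchingModConstants_of_schemaTower (hvol : 0 < vol) (hC : 0 < C) (hB₀ : 0 ≤ B₀) (hν : ∀ K, IsProbabilityMeasure (ν K))
    (hκM : ∀ K, IsMarkovKernel (κ K)) (hκC : ∀ K b, HasEntropyExpC1c (κ K b) C) (hGm : ∀ K, Measurable (G K))
    (hG : ∀ K b, ContDiff ℝ 1 fun x => G K (b, x)) (hGb : ∀ K p, |G K p| ≤ B₀) (hGD : ∀ K b x, ‖fderiv ℝ (fun z => G K (b, z)) x‖ ≤ L K)
    (hL : ∀ K, 0 < L K) (hgm : ∀ K, Measurable (g K)) (hgb : ∀ K b, |g K b| ≤ δ K) (he : ∀ K, Measurable (e K))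
    (hFm : ∀ K, Measurable (F K)) (hFb : ∀ K x, |F K x| ≤ B₀) (hFe : ∀ K p, F (K + 1) (e K p) = G K p) (hε0 : ∀ K, 0 ≤ ε K)
    (hε : ∀ K b, |F K b - ∫ x, G K (b, x) ∂(κ K b)| ≤ ε K) (hA : ∀ K, μ K = (ν K).tilted (g K))
    (hB : ∀ K, μ (K + 1) = ((ν K) ⊗ₘ κ K).map (e K)) (hZ : ∀ K t, Z K t = mgf (F K) (μ K) t) :
    MatchingModConstants vol l₀
      (fun K => l₀ / vol * (l₀ * (C * Real.exp (4 * l₀ * B₀) * L K ^ 2) + B₀ * (Real.exp (C * L K ^ 2 * l₀ ^ 2) - 1) + B₀ * (Real.exp (2 * δ K) - 1) +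
        (ε K + B₀ * (Real.exp (2 * (l₀ * ε K)) - 1)))) Z := by
  -- every run law is a probability law (a tilt is normalised)
  haveI : ∀ K, IsFiniteMeasure (μ K) := fun K => by
    haveI := hν K
    have hgi : Integrable (fun b => Real.exp (g K b)) (ν K) := by
      have := Literature.Probability.Moments.integrable_exp_mul_of_abs_le_const (ν K) (hgm K) (hgb K) 1; simpa using this
    rw [hA K]
    haveI := isProbabilityMeasure_tilted hgi
    infer_instance
  refine matchingModConstants_of_tiltedMeans (μ := μ)
    (η := fun K => l₀ * (C * Real.exp (4 * l₀ * B₀) * L K ^ 2) + B₀ * (Real.exp (C * L K ^ 2 * l₀ ^ 2) - 1) + B₀ * (Real.exp (2 * δ K) - 1) +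
      (ε K + B₀ * (Real.exp (2 * (l₀ * ε K)) - 1))) hFm hFb hZ (fun K s hs => ?_) (fun K => ?_)
  · exact abs_tiltedMean_succ_sub_le hC hB₀ hν hκM hκC hGm hG hGb hGD hL hgm hgb he hFm hFb hFe hε0 hε hA hB K hs
  · exact le_of_eq (by field_simp)

/-- **THE REMAINDERS ARE SUMMABLE IFF THE THREE LETTERS ARE** [folklore ∘ §1]: `Σ (L K)² < ∞`, `Σ δ K < ∞` (`δ K ≥ 0`), `Σ ε K < ∞` (`ε K ≥ 0`)
⇒ `Summable η` (the young rate SQUARED plus the two defects). -/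
theorem summable_eta (hC : 0 ≤ C) (hL2 : Summable fun K => L K ^ 2) (hδ0 : ∀ K, 0 ≤ δ K) (hδ : Summable δ) (hε0 : ∀ K, 0 ≤ ε K)
    (hεs : Summable ε) :
    Summable fun K => l₀ * (C * Real.exp (4 * l₀ * B₀) * L K ^ 2) + B₀ * (Real.exp (C * L K ^ 2 * l₀ ^ 2) - 1) + B₀ * (Real.exp (2 * δ K) - 1) +
      (ε K + B₀ * (Real.exp (2 * (l₀ * ε K)) - 1)) := by
  have h1 : Summable fun K => l₀ * (C * Real.exp (4 * l₀ * B₀) * L K ^ 2) := (hL2.mul_left _).mul_left _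
  have h2 : Summable fun K => B₀ * (Real.exp (C * L K ^ 2 * l₀ ^ 2) - 1) := by
    refine (summable_exp_sub_one (a := fun K => C * L K ^ 2 * l₀ ^ 2) ?_ fun K => by positivity).mul_left B₀
    simpa [mul_comm, mul_assoc, mul_left_comm] using (hL2.mul_left C).mul_right (l₀ ^ 2)
  have h3 : Summable fun K => B₀ * (Real.exp (2 * δ K) - 1) :=
    (summable_exp_sub_one (a := fun K => 2 * δ K) (hδ.mul_left 2) fun K => by linarith [hδ0 K]).mul_left B₀
  have h4 : Summable fun K => ε K + B₀ * (Real.exp (2 * (l₀ * ε K)) - 1) := by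
    rcases le_or_gt 0 l₀ with hl | hl
    · exact hεs.add ((summable_exp_sub_one (a := fun K => 2 * (l₀ * ε K)) ((hεs.mul_left l₀).mul_left 2) fun K => by
        have := hε0 K; positivity).mul_left B₀)
    · -- for `l₀ < 0` the exponent is `≤ 0`: `x ≤ e^{x} − 1 ≤ 0`
      refine hεs.add (Summable.of_norm_bounded (g := fun K => |B₀| * (2 * (-l₀ * ε K))) (((hεs.mul_left (-l₀)).mul_left 2).mul_left |B₀|)
        fun K => ?_)
      rw [Real.norm_eq_abs, abs_mul]
      refine mul_le_mul_of_nonneg_left ?_ (abs_nonneg _)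
      have hx : 2 * (l₀ * ε K) ≤ 0 := by nlinarith [hε0 K]
      have hlo : 2 * (l₀ * ε K) ≤ Real.exp (2 * (l₀ * ε K)) - 1 := by linarith [Real.add_one_le_exp (2 * (l₀ * ε K))]
      have hhi : Real.exp (2 * (l₀ * ε K)) - 1 ≤ 0 := by linarith [Real.exp_le_one_iff.2 hx]
      rw [abs_of_nonpos hhi]
      linarith
  exact ((h1.add h2).add h3).add h4

/-- **THE GENERATING FUNCTIONS OF THE SCHEMA TOWER ARE CAUCHY** [folklore ∘ `matchingModConstants_of_schemaTower` + `summable_eta` +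
`T4CauchySum.cauchySeq_genFun`].  Under the hypotheses of `matchingModConstants_of_schemaTower` with `l₀ ≥ 0` and the three letters summable
(`Σ (L K)²`, `Σ δ K`, `Σ ε K`), every generating function `K ↦ genFun Z K t = log Z K t − log Z K 0`, `|t| ≤ l₀`, is a Cauchy sequence — the `ε → 0`
statement of the T⁴ programme (node U0's input) ON THE TEMPLATE. -/
theorem cauchySeq_genFun_of_schemaTower (hvol : 0 < vol) (hl₀ : 0 ≤ l₀) (hC : 0 < C) (hB₀ : 0 ≤ B₀) (hν : ∀ K, IsProbabilityMeasure (ν K))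
    (hκM : ∀ K, IsMarkovKernel (κ K)) (hκC : ∀ K b, HasEntropyExpC1c (κ K b) C) (hGm : ∀ K, Measurable (G K))
    (hG : ∀ K b, ContDiff ℝ 1 fun x => G K (b, x)) (hGb : ∀ K p, |G K p| ≤ B₀) (hGD : ∀ K b x, ‖fderiv ℝ (fun z => G K (b, z)) x‖ ≤ L K)
    (hL : ∀ K, 0 < L K) (hL2 : Summable fun K => L K ^ 2) (hgm : ∀ K, Measurable (g K)) (hδ0 : ∀ K, 0 ≤ δ K)
    (hgb : ∀ K b, |g K b| ≤ δ K) (hδ : Summable δ) (he : ∀ K, Measurable (e K)) (hFm : ∀ K, Measurable (F K))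
    (hFb : ∀ K x, |F K x| ≤ B₀) (hFe : ∀ K p, F (K + 1) (e K p) = G K p) (hε0 : ∀ K, 0 ≤ ε K)
    (hε : ∀ K b, |F K b - ∫ x, G K (b, x) ∂(κ K b)| ≤ ε K) (hεs : Summable ε) (hA : ∀ K, μ K = (ν K).tilted (g K))
    (hB : ∀ K, μ (K + 1) = ((ν K) ⊗ₘ κ K).map (e K)) (hZ : ∀ K t, Z K t = mgf (F K) (μ K) t) {t : ℝ} (ht : |t| ≤ l₀) :
    CauchySeq fun K => genFun Z K t :=
  cauchySeq_genFun (matchingModConstants_of_schemaTower hvol hC hB₀ hν hκM hκC hGm hG hGb hGD hL hgm hgb he hFm hFb hFe hε0 hε hA hB hZ) hl₀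
    ((summable_eta hC.le hL2 hδ0 hδ hε0 hεs).mul_left _) ht

end Tower

/-! ## §4 The uniformly log-concave instance: whole-space convex fibres, `C = 1∕λ` by file A's Bakry–Émery schema -/
section Convex

variable {Ω : ℕ → Type*} [∀ K, MeasurableSpace (Ω K)] {d : ℕ → ℕ} {l₀ B₀ lam vol : ℝ} {L δ ε : ℕ → ℝ}
  {μ ν : ∀ K, Measure (Ω K)} {κ : ∀ K, Kernel (Ω K) (EuclideanSpace ℝ (Fin (d K)))}
  {G V : ∀ K, Ω K × EuclideanSpace ℝ (Fin (d K)) → ℝ} {g : ∀ K, Ω K → ℝ} {e : ∀ K, Ω K × EuclideanSpace ℝ (Fin (d K)) → Ω (K + 1)}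
  {F : ∀ K, Ω K → ℝ} {Z : ℕ → ℝ → ℝ}

/-- **N19's SHAPE ON THE CONVEX TOWER** [folklore ∘ §3; cite: BakryGentilLedoux2014, Prop. 5.4.1 — PROVED in the tree, file A].  As
`matchingModConstants_of_schemaTower` with the schema SUPPLIED: every fibre law is `e^{−V K (b,·)}dx∕Z` with `V K (b,·)` continuous and `λ`-uniformly
convex in the first-order letter, `e^{−V K (b,·)}` integrable — uniformly in `K`, `b` (NODE O's positivity statement, here a HYPOTHESIS); `C = 1∕λ`. -/
theorem matchingModConstants_of_convexTower (hvol : 0 < vol) (hlam : 0 < lam) (hB₀ : 0 ≤ B₀) (hν : ∀ K, IsProbabilityMeasure (ν K))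
    (hκM : ∀ K, IsMarkovKernel (κ K))
    (hκ : ∀ K b, κ K b = (volume : Measure (EuclideanSpace ℝ (Fin (d K)))).tilted fun x => -V K (b, x))
    (hVc : ∀ K b, Continuous fun x => V K (b, x))
    (hV : ∀ K b (x y : EuclideanSpace ℝ (Fin (d K))),
      V K (b, x) + ⟪gradient (fun z => V K (b, z)) x, y - x⟫ + lam / 2 * ‖y - x‖ ^ 2 ≤ V K (b, y))
    (hVZ : ∀ K b, Integrable fun x => Real.exp (-V K (b, x))) (hGm : ∀ K, Measurable (G K))
    (hG : ∀ K b, ContDiff ℝ 1 fun x => G K (b, x)) (hGb : ∀ K p, |G K p| ≤ B₀) (hGD : ∀ K b x, ‖fderiv ℝ (fun z => G K (b, z)) x‖ ≤ L K)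
    (hL : ∀ K, 0 < L K) (hgm : ∀ K, Measurable (g K)) (hgb : ∀ K b, |g K b| ≤ δ K) (he : ∀ K, Measurable (e K))
    (hFm : ∀ K, Measurable (F K)) (hFb : ∀ K x, |F K x| ≤ B₀) (hFe : ∀ K p, F (K + 1) (e K p) = G K p) (hε0 : ∀ K, 0 ≤ ε K)
    (hε : ∀ K b, |F K b - ∫ x, G K (b, x) ∂(κ K b)| ≤ ε K) (hA : ∀ K, μ K = (ν K).tilted (g K))
    (hB : ∀ K, μ (K + 1) = ((ν K) ⊗ₘ κ K).map (e K)) (hZ : ∀ K t, Z K t = mgf (F K) (μ K) t) :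
    MatchingModConstants vol l₀
      (fun K => l₀ / vol * (l₀ * (1 / lam * Real.exp (4 * l₀ * B₀) * L K ^ 2) + B₀ * (Real.exp (1 / lam * L K ^ 2 * l₀ ^ 2) - 1) +
        B₀ * (Real.exp (2 * δ K) - 1) + (ε K + B₀ * (Real.exp (2 * (l₀ * ε K)) - 1)))) Z :=
  matchingModConstants_of_schemaTower hvol (one_div_pos.2 hlam) hB₀ hν hκM
    (fun K b => by
      rw [hκ K b]
      exact fun φ hφ hφs => entropyC1c_of_uniformlyConvex hlam (hVc K b) (hV K b) (hVZ K b) φ hφ hφs)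
    hGm hG hGb hGD hL hgm hgb he hFm hFb hFe hε0 hε hA hB hZ

end Convex

end YMDAG.N14.ConvexFibreCauchy

end
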